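import Summits.Ventures.Crystal3D.Theorems.StickyWulffConstantTextureLiminfTexShadowCoverageBarlowAtDefs
import Summits.Ventures.Crystal3D.Theorems.StickyWulffConstantTextureLiminfTexShadowCoverageBarlowGlue
import Summits.Ventures.Crystal3D.Theorems.StickyWulffConstantTextureLiminfLineCountGlueOneSidedUpTop
import Summits.Ventures.Crystal3D.Theorems.StickyWulffConstantTextureLiminfTexShadowPresentationFlip
import Summits.Ventures.Crystal3D.Theorems.StickyWulffConstantGenericWallFloorBarlowReversal
import HarnessLib

/-!
# TexShadow row (e), K3 glue over the full family MENU: chosen-slot certificates ⇒ the cell (by `bilayerWallAt_of_K1a_at/_top_at` and the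
# presentation flips), menu certificate on `Reg` ⇒ `BilayerWallFaultedOnAt Reg`, and the row-(e) closer over the menu
# (lane T, crux `TextureLiminfV5`, stmt-Ventures-23912; EDGE-ON-MEMO R1 «chosen slots next»)

HONEST FRAMING. Venture `Summits/Ventures/Crystal3D` (cell `crystal3d-full`), route `route-Ventures-StickyWulffConstant`, helper
`--supports` the law-v5 crux `TextureLiminfV5` (stmt-Ventures-23912).  PURE BOOKKEEPING (census-free, standard axioms); every wall input is a
HYPOTHESIS; no certificate is proved or claimed; rung F-C1 not moved.

WHAT.
* `bilayerWallAt_of_barlowUpCertifiedAt` — `BarlowUpCertifiedAt c₀ σ₁ L₁ L₂ v` ⇒ the cell at `C(R₀) = (318 + 192R₀ + 80(R₀+9) + 3456 + 1152(R₀+1))/2` (`R₀ ≥ 6`) for every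
  table `0 ≤ c ≤ c₀`: if plate 1 is presented up, `bilayerWallAt_of_K1a_at` (p693671) directly with `hdom` from the two rise clauses; otherwise on the flipped presentation
  `(basalMirror.trans L₁, n ↦ −σ₁(−n−1))` with the re-indexed table `c (−i−1) j` (`bilayerRise_reverse` for the ∇ clause) and back by `bilayerWallAt_flip₁`;
  `bilayerWallAt_of_barlowDownCertifiedAt` — the mirror (`bilayerWallAt_of_K1a_top_at` p694292, `bilayerWallAt_flip₂`).
* `bilayerWallAt_of_barlowMenuCertified`, `faultedOnAt_of_menuCoverageBarlowOn` — same targets as the canonical glue (…CoverageBarlowGlue), so `residualFaultedCoreAt_of_split`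
  composes unchanged; `residualFaultedCoreAt_of_menuCoverageBarlowOn(')`, `residualFaultedCoreAt_of_menuCoverageBarlow`, and
  **`stub_residualFaultedCore_of_menuCoverageBarlow : P5Exhaustion → StarPairFar → ResidualMenuCoverageBarlow (13/25) → (∃ C, BilayerWallResidualFaultedEdgeOnAt (13/25) C 10) →
  ∃ C, BilayerWallResidualFaultedCoreAt (13/25) C 10`**.
WHAT THIS IS NOT: no certificate; K1b (steering `z ≠ e₃`) not consumed; F-C1 not moved.
-/

noncomputable section

namespace Summit.Ventures.Crystal3D.Cruxes.TextureLiminf.TexShadow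

open Summit.Ventures.Crystal3D Summit.Ventures.Crystal3D.Theorems Finset
open Literature.MathematicalPhysics.StatisticalMechanics (IsHaggSeq fccStacking barlowStacking basalMirror)
open scoped InnerProductSpace

/-- `√2·c₀ ≤ r` gives `c₀ ≤ √2·r/2`. -/
private theorem le_sqrt_two_mul_div_two' {c₀ r : ℝ} (h : Real.sqrt 2 * c₀ ≤ r) : c₀ ≤ Real.sqrt 2 * r / 2 := by
  have h2 : Real.sqrt 2 * Real.sqrt 2 = 2 := Real.mul_self_sqrt (by norm_num)
  have hnn : 0 ≤ Real.sqrt 2 / 2 * (r - Real.sqrt 2 * c₀) :=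
    mul_nonneg (div_nonneg (Real.sqrt_nonneg 2) zero_le_two) (sub_nonneg.2 h)
  have hid : Real.sqrt 2 * r / 2 - c₀ = Real.sqrt 2 / 2 * (r - Real.sqrt 2 * c₀) := by
    linear_combination (c₀ / 2) * h2
  linarith [hid, hnn]

/-! ## Chosen-slot certificates ⇒ the cell -/

/-- **UP family with chosen slot certified ⇒ the cell**, for every table `0 ≤ c ≤ c₀` (`R₀ ≥ 6`), in EITHER presentation of plate 1. -/
theorem bilayerWallAt_of_barlowUpCertifiedAt {sE : E3} (hsE : sE ∈ fccSlots) (hcert : ExactOnly 0 (fccSlots.filter fun w => 0 < ⟪w, sE⟫_ℝ))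
    (hDS : ∀ F₁ F₂ : E3 ≃ₗᵢ[ℝ] E3, DoubleStarCoaxialAt F₁ F₂) (hCP : CapPairCoaxial)
    {σ₁ σ₂ : ℤ → ℤ} (hσ₁ : IsHaggSeq σ₁) (hσ₂ : IsHaggSeq σ₂) (L₁ L₂ : E3 ≃ₗᵢ[ℝ] E3) (s₁ s₂ : E3)
    {c₀ : ℝ} {v : E3} (hcov : BarlowUpCertifiedAt c₀ σ₁ L₁ L₂ v) (R₀ : ℝ) (hR₀ : 6 ≤ R₀)
    (c : ℤ → ℤ → ℝ) (hc0 : ∀ i j, 0 ≤ c i j) (hcc : ∀ i j, c i j ≤ c₀) :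
    BilayerWallAt ((318 + 192 * R₀ + 80 * (R₀ + 9) + 3456 + 1152 * (R₀ + 1)) / 2) R₀ σ₁ σ₂ L₁ L₂ s₁ s₂ c := by
  obtain ⟨hv, hv2, hsteep, hrise, hall, hapart⟩ := hcov
  by_cases hax : 0 ≤ (L₁.symm e₃) 2
  · have hup : upFrame L₁ e₃ = L₁ := by unfold upFrame; rw [if_pos hax]
    rw [hup] at hsteep hrise hapart
    refine bilayerWallAt_of_K1a_at hsE hcert hDS hCP hσ₁ hσ₂ L₁ L₂ s₁ s₂ hax hv hv2 hsteep hapart R₀ hR₀ c hc0 ?_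
    intro i j
    refine (hcc i j).trans ?_
    split_ifs with h1
    · exact le_sqrt_two_mul_div_two' hrise
    · exact le_sqrt_two_mul_div_two' (hall i)
  · have hneg : (L₁.symm e₃) 2 < 0 := lt_of_not_ge hax
    have hup : upFrame L₁ e₃ = basalMirror.trans L₁ := by unfold upFrame; rw [if_neg hax]
    rw [hup] at hsteep hrise hapart
    have hσ₁' : IsHaggSeq (fun n => -σ₁ (-n - 1)) := isHaggSeq_reverse hσ₁
    have hax' : 0 ≤ ((basalMirror.trans L₁).symm e₃) 2 := by
      have h := upFrame_axis_nonneg L₁ e₃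
      rwa [hup] at h
    have key := bilayerWallAt_of_K1a_at hsE hcert hDS hCP hσ₁' hσ₂ (basalMirror.trans L₁) L₂ s₁ s₂ hax' hv hv2 hsteep hapart R₀ hR₀
      (fun i j => c (-i - 1) j) (fun i j => hc0 _ _) (fun i j => by
        refine (hcc _ _).trans ?_
        split_ifs with h1
        · exact le_sqrt_two_mul_div_two' hrise
        · rw [bilayerRise_reverse L₁ hσ₁ e₃ hneg i]; exact le_sqrt_two_mul_div_two' (hall _))
    exact bilayerWallAt_flip₁.1 key

/-- **DOWN family with chosen slot certified ⇒ the cell**, for every table `0 ≤ c ≤ c₀` (`R₀ ≥ 6`), in EITHER presentation of plate 2. -/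
theorem bilayerWallAt_of_barlowDownCertifiedAt {sE : E3} (hsE : sE ∈ fccSlots) (hcert : ExactOnly 0 (fccSlots.filter fun w => 0 < ⟪w, sE⟫_ℝ))
    (hDS : ∀ F₁ F₂ : E3 ≃ₗᵢ[ℝ] E3, DoubleStarCoaxialAt F₁ F₂) (hCP : CapPairCoaxial)
    {σ₁ σ₂ : ℤ → ℤ} (hσ₁ : IsHaggSeq σ₁) (hσ₂ : IsHaggSeq σ₂) (L₁ L₂ : E3 ≃ₗᵢ[ℝ] E3) (s₁ s₂ : E3)
    {c₀ : ℝ} {v : E3} (hcov : BarlowDownCertifiedAt c₀ σ₂ L₁ L₂ v) (R₀ : ℝ) (hR₀ : 6 ≤ R₀)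
    (c : ℤ → ℤ → ℝ) (hc0 : ∀ i j, 0 ≤ c i j) (hcc : ∀ i j, c i j ≤ c₀) :
    BilayerWallAt ((318 + 192 * R₀ + 80 * (R₀ + 9) + 3456 + 1152 * (R₀ + 1)) / 2) R₀ σ₁ σ₂ L₁ L₂ s₁ s₂ c := by
  obtain ⟨hv, hv2, hsteep, hrise, hall, hapart⟩ := hcov
  by_cases hax : 0 ≤ (L₂.symm (-e₃)) 2
  · have hup : upFrame L₂ (-e₃) = L₂ := by unfold upFrame; rw [if_pos hax]
    rw [hup] at hsteep hrise hapart
    refine bilayerWallAt_of_K1a_top_at hsE hcert hDS hCP hσ₁ hσ₂ L₁ L₂ s₁ s₂ hax hv hv2 hsteep hapart R₀ hR₀ c hc0 ?_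
    intro i j
    refine (hcc i j).trans ?_
    split_ifs with h1
    · exact le_sqrt_two_mul_div_two' hrise
    · exact le_sqrt_two_mul_div_two' (hall j)
  · have hneg : (L₂.symm (-e₃)) 2 < 0 := lt_of_not_ge hax
    have hup : upFrame L₂ (-e₃) = basalMirror.trans L₂ := by unfold upFrame; rw [if_neg hax]
    rw [hup] at hsteep hrise hapart
    have hσ₂' : IsHaggSeq (fun n => -σ₂ (-n - 1)) := isHaggSeq_reverse hσ₂
    have hax' : 0 ≤ ((basalMirror.trans L₂).symm (-e₃)) 2 := by
      have h := upFrame_axis_nonneg L₂ (-e₃)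
      rwa [hup] at h
    have key := bilayerWallAt_of_K1a_top_at hsE hcert hDS hCP hσ₁ hσ₂' L₁ (basalMirror.trans L₂) s₁ s₂ hax' hv hv2 hsteep hapart R₀ hR₀
      (fun i j => c i (-j - 1)) (fun i j => hc0 _ _) (fun i j => by
        refine (hcc _ _).trans ?_
        split_ifs with h1
        · exact le_sqrt_two_mul_div_two' hrise
        · rw [bilayerRise_reverse L₂ hσ₂ (-e₃) hneg j]; exact le_sqrt_two_mul_div_two' (hall _))
    exact bilayerWallAt_flip₂.1 key

/-- **Menu-certified ⇒ the cell.** -/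
theorem bilayerWallAt_of_barlowMenuCertified {sE : E3} (hsE : sE ∈ fccSlots) (hcert : ExactOnly 0 (fccSlots.filter fun w => 0 < ⟪w, sE⟫_ℝ))
    (hDS : ∀ F₁ F₂ : E3 ≃ₗᵢ[ℝ] E3, DoubleStarCoaxialAt F₁ F₂) (hCP : CapPairCoaxial)
    {σ₁ σ₂ : ℤ → ℤ} (hσ₁ : IsHaggSeq σ₁) (hσ₂ : IsHaggSeq σ₂) (L₁ L₂ : E3 ≃ₗᵢ[ℝ] E3) (s₁ s₂ : E3)
    {c₀ : ℝ} (hcov : BarlowMenuCertified c₀ σ₁ σ₂ L₁ L₂) (R₀ : ℝ) (hR₀ : 6 ≤ R₀)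
    (c : ℤ → ℤ → ℝ) (hc0 : ∀ i j, 0 ≤ c i j) (hcc : ∀ i j, c i j ≤ c₀) :
    BilayerWallAt ((318 + 192 * R₀ + 80 * (R₀ + 9) + 3456 + 1152 * (R₀ + 1)) / 2) R₀ σ₁ σ₂ L₁ L₂ s₁ s₂ c := by
  rcases hcov with hcan | ⟨v, hup⟩ | ⟨v, hdown⟩
  · exact bilayerWallAt_of_barlowOneSidedCertified hsE hcert hDS hCP hσ₁ hσ₂ L₁ L₂ s₁ s₂ hcan R₀ hR₀ c hc0 hcc
  · exact bilayerWallAt_of_barlowUpCertifiedAt hsE hcert hDS hCP hσ₁ hσ₂ L₁ L₂ s₁ s₂ hup R₀ hR₀ c hc0 hcc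
  · exact bilayerWallAt_of_barlowDownCertifiedAt hsE hcert hDS hCP hσ₁ hσ₂ L₁ L₂ s₁ s₂ hdown R₀ hR₀ c hc0 hcc

/-! ## Menu certificate on `Reg` ⇒ the on-`Reg` law ⇒ the core -/

/-- **Menu certificate on `Reg` ⇒ `BilayerWallFaultedOnAt Reg c₀ C(R₀) R₀`** (`R₀ ≥ 6`). -/
theorem faultedOnAt_of_menuCoverageBarlowOn {sE : E3} (hsE : sE ∈ fccSlots) (hcert : ExactOnly 0 (fccSlots.filter fun w => 0 < ⟪w, sE⟫_ℝ))
    (hDS : ∀ F₁ F₂ : E3 ≃ₗᵢ[ℝ] E3, DoubleStarCoaxialAt F₁ F₂) (hCP : CapPairCoaxial)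
    {Reg : (ℤ → ℤ) → (ℤ → ℤ) → (E3 ≃ₗᵢ[ℝ] E3) → (E3 ≃ₗᵢ[ℝ] E3) → Prop} {c₀ : ℝ}
    (hcov : ResidualMenuCoverageBarlowOn Reg c₀) {R₀ : ℝ} (hR₀ : 6 ≤ R₀) :
    BilayerWallFaultedOnAt Reg c₀ ((318 + 192 * R₀ + 80 * (R₀ + 9) + 3456 + 1152 * (R₀ + 1)) / 2) R₀ := by
  intro σ₁ σ₂ hσ₁ hσ₂ hf L₁ L₂ s₁ s₂ A₁ A₂ u₁ u₂ _ _ hreg c m hadm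
  exact bilayerWallAt_of_barlowMenuCertified hsE hcert hDS hCP hσ₁ hσ₂ L₁ L₂ s₁ s₂ (hcov σ₁ σ₂ hσ₁ hσ₂ hf L₁ L₂ hreg)
    R₀ hR₀ c hadm.1 hadm.2.1

/-- **THE ROW-(e) CLOSER OVER THE MENU, `ExactOnly` form** (`R₀ ≥ 6`). -/
theorem residualFaultedCoreAt_of_menuCoverageBarlowOn {sE : E3} (hsE : sE ∈ fccSlots)
    (hcert : ExactOnly 0 (fccSlots.filter fun w => 0 < ⟪w, sE⟫_ℝ))
    (hDS : ∀ F₁ F₂ : E3 ≃ₗᵢ[ℝ] E3, DoubleStarCoaxialAt F₁ F₂) (hCP : CapPairCoaxial)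
    {Reg Rem : (ℤ → ℤ) → (ℤ → ℤ) → (E3 ≃ₗᵢ[ℝ] E3) → (E3 ≃ₗᵢ[ℝ] E3) → Prop}
    (hcover : ∀ σ₁ σ₂ L₁ L₂, Reg σ₁ σ₂ L₁ L₂ ∨ Rem σ₁ σ₂ L₁ L₂) {c₀ : ℝ} (hcov : ResidualMenuCoverageBarlowOn Reg c₀)
    {R₀ : ℝ} (hR₀ : 6 ≤ R₀) (hrem : ∃ C : ℝ, BilayerWallResidualFaultedCoreOnAt Rem c₀ C R₀) :
    ∃ C : ℝ, BilayerWallResidualFaultedCoreAt c₀ C R₀ := by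
  obtain ⟨C₂, h₂⟩ := hrem
  exact ⟨_, residualFaultedCoreAt_of_split hcover (by linarith) (faultedOnAt_of_menuCoverageBarlowOn hsE hcert hDS hCP hcov hR₀) h₂⟩

/-- **THE ROW-(e) CLOSER OVER THE MENU, named-fact form**: `P5Exhaustion → StarPairFar → menu certificate on Reg → (∃ C, core on Rem) → ∃ C, core`, `Reg ∨ Rem` exhaustive. -/
theorem residualFaultedCoreAt_of_menuCoverageBarlowOn' (hE1 : P5Exhaustion) (hSP : StarPairFar)
    {Reg Rem : (ℤ → ℤ) → (ℤ → ℤ) → (E3 ≃ₗᵢ[ℝ] E3) → (E3 ≃ₗᵢ[ℝ] E3) → Prop}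
    (hcover : ∀ σ₁ σ₂ L₁ L₂, Reg σ₁ σ₂ L₁ L₂ ∨ Rem σ₁ σ₂ L₁ L₂) {c₀ : ℝ} (hcov : ResidualMenuCoverageBarlowOn Reg c₀)
    {R₀ : ℝ} (hR₀ : 6 ≤ R₀) (hrem : ∃ C : ℝ, BilayerWallResidualFaultedCoreOnAt Rem c₀ C R₀) :
    ∃ C : ℝ, BilayerWallResidualFaultedCoreAt c₀ C R₀ := by
  obtain ⟨sE, hsE, hcert⟩ := exactOnly_star_of_p5Exhaustion hE1
  exact residualFaultedCoreAt_of_menuCoverageBarlowOn hsE hcert (doubleStarCoaxialAt_of_starPairFar hSP)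
    (capPairCoaxial_of_starPairFar hSP) hcover hcov hR₀ hrem

open scoped Classical in
/-- **Core = menu certificate outside edge-on + K4** (`R₀ ≥ 6`). -/
theorem residualFaultedCoreAt_of_menuCoverageBarlow (hE1 : P5Exhaustion) (hSP : StarPairFar) {c₀ : ℝ}
    (hcov : ResidualMenuCoverageBarlow c₀) {R₀ : ℝ} (hR₀ : 6 ≤ R₀)
    (hK4 : ∃ C : ℝ, BilayerWallResidualFaultedEdgeOnAt c₀ C R₀) :
    ∃ C : ℝ, BilayerWallResidualFaultedCoreAt c₀ C R₀ :=
  residualFaultedCoreAt_of_menuCoverageBarlowOn' hE1 hSP (Rem := EdgeOnAt c₀)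
    (fun σ₁ σ₂ L₁ L₂ => (em (EdgeOnAt c₀ σ₁ σ₂ L₁ L₂)).symm) hcov hR₀ hK4

/-- **`stub_residualFaultedCore` BY NAME modulo {E1, StarPairFar, the MENU certificate at `13/25`, K4 at `(13/25, 10)`}.** -/
theorem stub_residualFaultedCore_of_menuCoverageBarlow (hE1 : P5Exhaustion) (hSP : StarPairFar)
    (hcov : ResidualMenuCoverageBarlow (13 / 25)) (hK4 : ∃ C : ℝ, BilayerWallResidualFaultedEdgeOnAt (13 / 25) C 10) :
    ∃ C : ℝ, BilayerWallResidualFaultedCoreAt (13 / 25) C 10 :=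
  residualFaultedCoreAt_of_menuCoverageBarlow hE1 hSP hcov (by norm_num) hK4

end Summit.Ventures.Crystal3D.Cruxes.TextureLiminf.TexShadow

end
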